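import Summits.PneNP.PneNP.Theses.Nc03AvoidResidualCore
import Summits.PneNP.PneNP.Theorems.Nc03AvoidResidualCoreCandCherry

/-!
# Birth skeleton (BC3) for the crux `CandStarReduction` (stmt-PneNP-19963, route-PneNP-Nc03AvoidResidualCore rev 8)

X₂ = `CandStarReduction : CandMatchAvoidLinearFP → CandAvoidLinearFP` — the ★-reduction of the cell memo
pnp-ideate-p2/ROUND-3-ADDENDUM-B, Thm B.1: CAND^match-AVOID-linear ∈ FP ⇒ CAND^pure-AVOID-linear ∈ FP
(stretch constant + 1).  Two registered-shape stubs, the sorry-free assembly `CandStarReduction_of_stubs` and the skeleton theorem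
`CandStarReduction_of`, which concludes the crux BY NAME.  Sorries ONLY inside `stub_*`.

The split of Thm B.1: let `L = tangled I` (outputs sharing their head AND a data variable with another
output; `Nc03AvoidResidualCoreCandCherry.tangled`, landed p487884).
* `#L ≥ n + 1` (tangled surplus): cherry forcing (F2, `apex_eq_true_of_cherry`) along a forcing forest
  (Lemma B.2 coverage, Lemma B.3 acyclicity) makes every tangled output AFFINE on the valid slice, and an
  affine family of dimension `≤ n < n + 1 ≤ #L` is avoided by Gaussian elimination over 𝔽₂ — in FP.
  This is `stub_cherryStar : TangledSurplusFP` (L-sized, load-bearing; kit j244555: 1206/1206 certified).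
* `#L ≤ n`: the untangled outputs (`≥ m - n` of them) restrict to a PURE MATCHING-CLASS sub-instance on the
  same inputs (`untangled_isMatchingClass`, `restrict_isPure`), so the X₁-solver's point re-embeds
  (`not_mem_range_of_untangled`); branch + two sub-solvers compose in FP (CodeFP kit of
  `…ReductionAssemblyFP`).  This is `stub_tangledSplit` (M-sized).

Restricted-model (NC⁰₃) range-avoidance rung F-N1b of the PneNP frontier ladder; no bearing on P vs NP.
tribunal-w g6, 2026-08-27.
-/

namespace Summit.PneNP.PneNP.Cruxes.CandStarReduction.Birth

open Finset
open Literature.Computability.Complexity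
open Summit.PneNP.PneNP.Theses.Nc03AvoidResidualCore
  (CandMatchAvoidLinearFP CandStarReduction CandAvoidLinearFP)
open Summit.PneNP.PneNP.Theorems.Nc03AvoidResidualCoreCandCherry (tangled)

/-- ★-core as a Prop (Thm B.1, first sentence): ONE polynomial-time avoider for every pure-CAND instance
with at least `n + 1` tangled outputs. -/
def TangledSurplusFP : Prop :=
  ∃ f : List Bool → List Bool, IsPolyTime f ∧
    ∀ n m (I : LocalMap 3 n m), I.IsPure candPred → 0 < n → n + 1 ≤ #(tangled I) →
      readOut m (f I.encode) ∉ I.range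

/-- STUB 1 (L-sized, load-bearing): Thm B.1 ★ — cherry forcing (F2), the forcing forest (Lemma B.2
coverage, Lemma B.3 acyclicity), affine avoidance by elimination over 𝔽₂, all in FP (CodeFP kit of
`…ReductionAssemblyFP`).  First lemmas landed in `…CandCherry` (`apex_eq_true_of_cherry`,
`eval_of_data_true₁/₂`, `cherry_xor₁₁`) and `…CandFewHeadsRung.not_mem_range_of_parallel` (F1). -/
theorem stub_cherryStar : TangledSurplusFP := by
  sorry

/-- STUB 2 (M-sized): the branch of Thm B.1 "Consequently" — if `#(tangled I) ≤ n`, the untangled outputs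
(`≥ m - n ≥ C′·n` of them once `m ≥ (C′+1)·n`) form a pure matching-class sub-instance on the same `n`
inputs (`untangled_isMatchingClass`, `restrict_isPure`, `card_compl_tangled`); a point avoiding ITS range
(the X₁-solver) re-embeds by `not_mem_range_of_untangled`; else call the ★-solver of STUB 1; the branch and
both calls compose in FP.  Stretch constant `C′ + 1`. -/
theorem stub_tangledSplit :
    CandMatchAvoidLinearFP → TangledSurplusFP → CandAvoidLinearFP := by
  sorry

/-- ASSEMBLY (kernel-checked, no sorry): the two stub STATEMENTS imply the crux `CandStarReduction`. -/
theorem CandStarReduction_of_stubs (h₁ : TangledSurplusFP)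
    (h₂ : CandMatchAvoidLinearFP → TangledSurplusFP → CandAvoidLinearFP) :
    Summit.PneNP.PneNP.Theses.Nc03AvoidResidualCore.CandStarReduction :=
  fun hX₁ => h₂ hX₁ h₁

/-- THE SKELETON THEOREM (registrar shape): the crux
`Summit.PneNP.PneNP.Theses.Nc03AvoidResidualCore.CandStarReduction` concluded BY NAME from the two declared
stubs through the sorry-free assembly `CandStarReduction_of_stubs`; the only `sorry`s in its closure are
`stub_cherryStar` and `stub_tangledSplit`. -/
theorem CandStarReduction_of :
    Summit.PneNP.PneNP.Theses.Nc03AvoidResidualCore.CandStarReduction :=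
  CandStarReduction_of_stubs stub_cherryStar stub_tangledSplit

end Summit.PneNP.PneNP.Cruxes.CandStarReduction.Birth
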